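import Summits.CriticalPhenomena.SAWScalingLimit.Theorems.SAWDefectDecoherenceBoundaryClosureRIdentificationGateReflection
import Literature.NumberTheory.Transcendental.ExpDominantSolvabilityLogRatio

/-!
# `BoundaryClosureR`, line `pick-half-plane`, stub `stub_identification`: the glue
# `GateTrace → Identification`

Sub-goal `identification_of_gateTrace` of the stub `stub_identification` (crux
stmt-CriticalPhenomena-14004).  `GateTrace` is the one remaining analytic-lattice input of the Pick
closing argument, stated with the skeleton's line-local abbreviations (`AdmissibleFamily`,
`PinnedFlatRoot`, `IsPickCupLimit`, `flatPoints`, `IsWeakLimit`, `IsTest`, `NF`) UNFOLDED verbatim: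
with ONE universal constant `c ≠ 0`, for every admissible datum, every root pinned at `D.pt 0`, every
admissible conformal datum `(Φ, L, L_b)`, every mesh sequence and every Pick–cup weak limit `g` of the
root, the function `g · exp(−(5/8)(L − L_b))` tends to `c` within the carrier at EVERY point of the
flat gate `{im z = im (D.pt 1)} ∩ B(D.pt 1, ρ)`.  The theorem `identification_of_gateTrace` turns it
into the skeleton's `Identification` (VERBATIM, unfolded; = the sibling line's): the continuous branch
`L` of `log Φ'` is holomorphic (`ExpDominant.differentiableOn_of_exp_eq`, a continuous logarithm of
the holomorphic `Φ'`), so `G := g · exp(−(5/8)(L − L_b))` is holomorphic on the carrier, and the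
landed reflection step `identification_gateReflection` (Schwarz reflection across the gate + isolated
zeros + identity theorem) gives `G ≡ c`, i.e. `g = c · exp((5/8)(L − L_b))` on the carrier.
No new definitions.
-/

noncomputable section

open scoped BigOperators ComplexConjugate Topology
open Filter Set MeasureTheory
open Literature.Probability.LatticeModels Literature.Probability.RandomPlanarGeometry
open Literature.Probability.RandomPlanarGeometry.SAW
open Summit.CriticalPhenomena.SAWScalingLimit.Theses.SAWDefectDecoherence

namespace Summit.CriticalPhenomena.SAWScalingLimit.Theorems.PickHalfPlane.Identification

/-- **The analytic core of the glue (registered sub-goal `identification_of_gateTrace_core`).** For a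
Dobrushin domain whose carrier is the open half-plane above `D.pt 1` inside `B(D.pt 1, ρ)`, a
continuous branch `L` of `log Φ'` on the carrier (`Φ` a conformal equivalence onto `ℍₒ`), and `g`
holomorphic on the carrier such that `g · exp(−(5/8)(L − L_b)) → c` within the carrier at every point
of the flat gate: `g = c · exp((5/8)(L − L_b))` on the carrier.  (`L` is holomorphic —
`ExpDominant.differentiableOn_of_exp_eq`; then `identification_gateReflection`.) [folklore] -/
theorem identification_of_gateTrace_core : ∀ (D : DobrushinDomain) (ρ : ℝ)
    (Φ : ConformalEquiv D.carrier UpperHalfPlane.upperHalfPlaneSet) (L : ℂ → ℂ) (Lb c : ℂ) (g : ℂ → ℂ),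
    0 < ρ → D.carrier ∩ Metric.ball (D.pt 1) ρ = {z : ℂ | (D.pt 1).im < z.im} ∩ Metric.ball (D.pt 1) ρ →
    ContinuousOn L D.carrier → (∀ z ∈ D.carrier, Complex.exp (L z) = deriv Φ z) →
    DifferentiableOn ℂ g D.carrier →
    (∀ y : ℂ, y.im = (D.pt 1).im → y ∈ Metric.ball (D.pt 1) ρ →
      Tendsto (fun z => g z * Complex.exp (-((5 / 8 : ℂ) * (L z - Lb)))) (𝓝[D.carrier] y) (𝓝 c)) →
    ∀ z ∈ D.carrier, g z = c * Complex.exp ((5 / 8 : ℂ) * (L z - Lb)) := by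
  intro D ρ Φ L Lb c g hρ hflat hL hexpL hg hgate
  have hU : IsOpen D.carrier := D.isOpen
  -- `L` is holomorphic: a continuous logarithm of the holomorphic `Φ'`
  have hΦ' : DifferentiableOn ℂ (deriv Φ) D.carrier :=
    ((Φ.differentiableOn.analyticOnNhd hU).deriv).differentiableOn
  have hLd : DifferentiableOn ℂ L D.carrier :=
    Literature.NumberTheory.Transcendental.ExpDominant.differentiableOn_of_exp_eq hU hL hΦ' hexpL
  -- `G := g · exp(−(5/8)(L − L_b))` is holomorphic on the carrier and tends to `c` along the gate
  set G : ℂ → ℂ := fun z => g z * Complex.exp (-((5 / 8 : ℂ) * (L z - Lb))) with hGdef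
  have hGd : DifferentiableOn ℂ G D.carrier :=
    hg.mul (((differentiableOn_const _).mul (hLd.sub (differentiableOn_const _))).neg.cexp)
  have hGc : ∀ z ∈ D.carrier, G z = c := identification_gateReflection D ρ G c hρ hflat hGd hgate
  intro z hz
  have h2 : Complex.exp (-((5 / 8 : ℂ) * (L z - Lb))) * Complex.exp ((5 / 8 : ℂ) * (L z - Lb)) = 1 := by
    rw [← Complex.exp_add, neg_add_cancel, Complex.exp_zero]
  calc g z = G z * Complex.exp ((5 / 8 : ℂ) * (L z - Lb)) := by
        rw [hGdef]; simp only; rw [mul_assoc, h2, mul_one]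
    _ = c * Complex.exp ((5 / 8 : ℂ) * (L z - Lb)) := by rw [hGc z hz]

/-- **The glue `GateTrace → Identification` (sub-goal `identification_of_gateTrace` of stub
`stub_identification`).** Antecedent: the gate trace of the Pick–cup weak limits with one universal
constant (skeleton vocabulary unfolded); consequent: the skeleton's `Identification`, verbatim
(unfolded).  Proof: `L` is holomorphic on the carrier (continuous logarithm of the holomorphic `Φ'`),
so `G := g · exp(−(5/8)(L − L_b))` is holomorphic there; by the gate hypothesis of the admissible
family and `identification_gateReflection`, `G ≡ c`; unwind (`identification_of_gateTrace_core`). [folklore] -/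
theorem identification_of_gateTrace :
    (∃ c : ℂ, c ≠ 0 ∧
    ∀ (D : DobrushinDomain) (ρ : ℝ) (Λ : ℝ → Finset HexVertex) (m : ℝ → ℤ) (b : ℝ → Sym2 HexVertex),
      (0 < ρ ∧
        D.carrier ∩ Metric.ball (D.pt 1) ρ = {z : ℂ | (D.pt 1).im < z.im} ∩ Metric.ball (D.pt 1) ρ ∧
        (∀ᶠ δ : ℝ in 𝓝[>] 0, hexDomainSimplyConnected (Λ δ) ∧ b δ ∈ hexDomainBoundary (Λ δ) ∧
            (hexGraph.induce ((Λ δ : Finset HexVertex) : Set HexVertex)).Preconnected ∧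
            (∀ v ∈ Λ δ, (δ : ℂ) * hexCenter v ∈ D.carrier) ∧
            (∀ v : HexVertex, (δ : ℂ) * hexCenter v ∈ Metric.ball (D.pt 1) ρ →
              (v ∈ Λ δ ↔ m δ ≤ v.1 1))) ∧
        (∀ K : Set ℂ, IsCompact K → K ⊆ D.carrier →
            ∀ᶠ δ : ℝ in 𝓝[>] 0, ∀ v : HexVertex, (δ : ℂ) * hexCenter v ∈ K → v ∈ Λ δ) ∧
        Tendsto (fun δ : ℝ => (δ : ℂ) * hexMidpoint (b δ)) (𝓝[>] 0) (𝓝 (D.pt 1))) →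
    ∀ (a : ℝ → Sym2 HexVertex) (r₀ : ℝ) (m₀ : ℝ → ℤ),
      (0 < r₀ ∧
        D.carrier ∩ Metric.ball (D.pt 0) r₀ = {z : ℂ | (D.pt 0).im < z.im} ∩ Metric.ball (D.pt 0) r₀ ∧
        (∀ᶠ δ : ℝ in 𝓝[>] 0, a δ ∈ hexDomainBoundary (Λ δ) ∧
            Nonempty (HexMidEdgeSAW (Λ δ) (a δ) (b δ)) ∧
            (∀ v : HexVertex, (δ : ℂ) * hexCenter v ∈ Metric.ball (D.pt 0) r₀ →
              (v ∈ Λ δ ↔ m₀ δ ≤ v.1 1))) ∧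
        Tendsto (fun δ : ℝ => (δ : ℂ) * hexMidpoint (a δ)) (𝓝[>] 0) (𝓝 (D.pt 0))) →
    ∀ (Φ : ConformalEquiv D.carrier UpperHalfPlane.upperHalfPlaneSet) (L : ℂ → ℂ) (Lb : ℂ),
      Tendsto (fun z => ‖Φ z‖) (𝓝[D.carrier] (D.pt 0)) atTop → Φ.HasBoundaryValue (D.pt 1) 0 →
      ContinuousOn L D.carrier → (∀ z ∈ D.carrier, Complex.exp (L z) = deriv Φ z) →
      Tendsto L (𝓝[D.carrier] (D.pt 1)) (𝓝 Lb) →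
    ∀ ns : ℕ → ℝ, Tendsto ns atTop (𝓝[>] 0) →
    ∀ g : ℂ → ℂ,
      (DifferentiableOn ℂ g D.carrier ∧
        (∃ κ : ℂ, κ ≠ 0 ∧
          Tendsto (fun z => g z * (z - D.pt 0) ^ ((5 : ℂ) / 4)) (𝓝[D.carrier] (D.pt 0)) (𝓝 κ)) ∧
        (∀ y ∈ ({z : ℂ | z.im = (D.pt 1).im} ∩ Metric.ball (D.pt 1) ρ) ∪
            ({z : ℂ | z.im = (D.pt 0).im} ∩ Metric.ball (D.pt 0) r₀),
          y ≠ D.pt 0 → ∃ w : ℂ, w ≠ 0 ∧ Tendsto g (𝓝[D.carrier] y) (𝓝 w))) →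
      (∀ ψ : ℂ → ℂ, (Continuous ψ ∧ HasCompactSupport ψ ∧ tsupport ψ ⊆ D.carrier) →
        Tendsto (fun n => ((ns n : ℝ) : ℂ) ^ 2 * (∑ᶠ z ∈ hexDomainMidEdges (Λ (ns n)),
            ψ (((ns n : ℝ) : ℂ) * hexMidpoint z) *
              hexParafermionicObservable (Λ (ns n)) (a (ns n)) hexCriticalFugacity (5 / 8) z) /
          hexParafermionicObservable (Λ (ns n)) (a (ns n)) hexCriticalFugacity (5 / 8) (b (ns n)))
          atTop (𝓝 (∫ z, ψ z * g z))) →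
      ∀ y : ℂ, y.im = (D.pt 1).im → y ∈ Metric.ball (D.pt 1) ρ →
        Tendsto (fun z => g z * Complex.exp (-((5 / 8 : ℂ) * (L z - Lb)))) (𝓝[D.carrier] y) (𝓝 c)) →
    ∃ c : ℂ, c ≠ 0 ∧
    ∀ (D : DobrushinDomain) (ρ : ℝ) (Λ : ℝ → Finset HexVertex) (m : ℝ → ℤ) (b : ℝ → Sym2 HexVertex),
      (0 < ρ ∧
        D.carrier ∩ Metric.ball (D.pt 1) ρ = {z : ℂ | (D.pt 1).im < z.im} ∩ Metric.ball (D.pt 1) ρ ∧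
        (∀ᶠ δ : ℝ in 𝓝[>] 0, hexDomainSimplyConnected (Λ δ) ∧ b δ ∈ hexDomainBoundary (Λ δ) ∧
            (hexGraph.induce ((Λ δ : Finset HexVertex) : Set HexVertex)).Preconnected ∧
            (∀ v ∈ Λ δ, (δ : ℂ) * hexCenter v ∈ D.carrier) ∧
            (∀ v : HexVertex, (δ : ℂ) * hexCenter v ∈ Metric.ball (D.pt 1) ρ →
              (v ∈ Λ δ ↔ m δ ≤ v.1 1))) ∧
        (∀ K : Set ℂ, IsCompact K → K ⊆ D.carrier →
            ∀ᶠ δ : ℝ in 𝓝[>] 0, ∀ v : HexVertex, (δ : ℂ) * hexCenter v ∈ K → v ∈ Λ δ) ∧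
        Tendsto (fun δ : ℝ => (δ : ℂ) * hexMidpoint (b δ)) (𝓝[>] 0) (𝓝 (D.pt 1))) →
    ∀ (a : ℝ → Sym2 HexVertex) (r₀ : ℝ) (m₀ : ℝ → ℤ),
      (0 < r₀ ∧
        D.carrier ∩ Metric.ball (D.pt 0) r₀ = {z : ℂ | (D.pt 0).im < z.im} ∩ Metric.ball (D.pt 0) r₀ ∧
        (∀ᶠ δ : ℝ in 𝓝[>] 0, a δ ∈ hexDomainBoundary (Λ δ) ∧
            Nonempty (HexMidEdgeSAW (Λ δ) (a δ) (b δ)) ∧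
            (∀ v : HexVertex, (δ : ℂ) * hexCenter v ∈ Metric.ball (D.pt 0) r₀ →
              (v ∈ Λ δ ↔ m₀ δ ≤ v.1 1))) ∧
        Tendsto (fun δ : ℝ => (δ : ℂ) * hexMidpoint (a δ)) (𝓝[>] 0) (𝓝 (D.pt 0))) →
    ∀ (Φ : ConformalEquiv D.carrier UpperHalfPlane.upperHalfPlaneSet) (L : ℂ → ℂ) (Lb : ℂ),
      Tendsto (fun z => ‖Φ z‖) (𝓝[D.carrier] (D.pt 0)) atTop → Φ.HasBoundaryValue (D.pt 1) 0 →
      ContinuousOn L D.carrier → (∀ z ∈ D.carrier, Complex.exp (L z) = deriv Φ z) →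
      Tendsto L (𝓝[D.carrier] (D.pt 1)) (𝓝 Lb) →
    ∀ ns : ℕ → ℝ, Tendsto ns atTop (𝓝[>] 0) →
    ∀ g : ℂ → ℂ,
      (DifferentiableOn ℂ g D.carrier ∧
        (∃ κ : ℂ, κ ≠ 0 ∧
          Tendsto (fun z => g z * (z - D.pt 0) ^ ((5 : ℂ) / 4)) (𝓝[D.carrier] (D.pt 0)) (𝓝 κ)) ∧
        (∀ y ∈ ({z : ℂ | z.im = (D.pt 1).im} ∩ Metric.ball (D.pt 1) ρ) ∪
            ({z : ℂ | z.im = (D.pt 0).im} ∩ Metric.ball (D.pt 0) r₀),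
          y ≠ D.pt 0 → ∃ w : ℂ, w ≠ 0 ∧ Tendsto g (𝓝[D.carrier] y) (𝓝 w))) →
      (∀ ψ : ℂ → ℂ, (Continuous ψ ∧ HasCompactSupport ψ ∧ tsupport ψ ⊆ D.carrier) →
        Tendsto (fun n => ((ns n : ℝ) : ℂ) ^ 2 * (∑ᶠ z ∈ hexDomainMidEdges (Λ (ns n)),
            ψ (((ns n : ℝ) : ℂ) * hexMidpoint z) *
              hexParafermionicObservable (Λ (ns n)) (a (ns n)) hexCriticalFugacity (5 / 8) z) /
          hexParafermionicObservable (Λ (ns n)) (a (ns n)) hexCriticalFugacity (5 / 8) (b (ns n)))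
          atTop (𝓝 (∫ z, ψ z * g z))) →
      ∀ z ∈ D.carrier, g z = c * Complex.exp ((5 / 8 : ℂ) * (L z - Lb)) := by
  rintro ⟨c, hc, hGT⟩
  refine ⟨c, hc, ?_⟩
  intro D ρ Λ m b hAF a r₀ m₀ hPR Φ L Lb hΦ hΦb hL hexpL hLb ns hns g hg hw
  exact identification_of_gateTrace_core D ρ Φ L Lb c g hAF.1 hAF.2.1 hL hexpL hg.1
    (hGT D ρ Λ m b hAF a r₀ m₀ hPR Φ L Lb hΦ hΦb hL hexpL hLb ns hns g hg hw)

end Summit.CriticalPhenomena.SAWScalingLimit.Theorems.PickHalfPlane.Identification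

end
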